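import Mathlib
import HarnessLib
import Summits.Ventures.LatticeQCDFlow.Exactness.SUNSpectralKernelShipped
import Summits.Ventures.LatticeQCDFlow.Exactness.SUNTorusAlcoveJacobian
import Summits.Ventures.LatticeQCDFlow.Exactness.KernelCouplingJacobian

/-!
# The `SU(N)` spectral COUPLING LAYER as shipped — every `N`, box coordinates, measurable data, hypotheses only at simple spectra — is an exact transport of `⊗ Haar` with the booked `coupleJac`

HONEST FRAMING: exact (Metropolis-corrected) sampling algorithms for lattice gauge theory;
figures of merit are autocorrelation/cost numbers at stated couplings and volumes; no
continuum-physics claim.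

Venture `LatticeQCDFlow` (cell pub-lqcd), topic `Exactness`; FANOUT row 10 (`eng-equiv`, engine
`latflow.equiv` `spectral.SUNSpectralCoupling.forward` = per active link: loop `W = u·S(frozen)`,
`W' = spectral_kernel(W | conditioner(frozen context))`, `u' = W' W⁻¹ u`, `ldj += log J(W)`; Boyda et
al., PRD 103 (2021) 074504 §III.C, App. B).  NEW WORK of the cell: the LAYER-LEVEL end of the
chain.  `SUNSpectralKernelShipped.lean` certifies ONE shipped kernel (`HasJacobian (Haar SU(n+1)) h J`
from the box flow, with every hypothesis on the eigenvalue map / kernel / density asked only at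
simple spectra); `KernelCouplingJacobian.hasJacobian_kernelCouplingLayer` assembles kernels read
from FROZEN links into the masked layer `Theory2.coupleFun`.  This file composes them; the two
auxiliary charts (`E`, `P`) of the kernel theorem are discharged inside (they exist:
`exists_angleChart_sun`, `exists_permDiag_family_sun`).  Nothing is assumed continuous; nothing
cited as a fact; no number; no definition.

* **`hasJacobian_spectralCouplingLayer_sun_shipped`** — THE LAYER: finite link set `ι`, mask `p`,
  per active link `a` and frozen links `y` a measurable staple `S a y`, a box flow `χ a y` with
  `HasJacobian (Leb|_B)`, shipped eigenvalue map `f a y`, kernel `h a y`, spectral datum `JD a y`,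
  density `j a y ≥ 0` — kernel and density JOINTLY MEASURABLE in (frozen links, loop), all
  algebraic hypotheses at simple spectra only — then
  `HasJacobian (⊗ Haar_{SU(n+1)}) (coupleFun p (u ↦ h a y (uS)(uS)⁻¹u)) (ofReal ∘ coupleJac p (j at the loops))`.
-/

noncomputable section

namespace Summit.Ventures.LatticeQCDFlow.Exactness

open MeasureTheory Matrix Set Real Finset
open Literature.LinearAlgebra.Matrix
open Literature.MathematicalPhysics.QuantumFieldTheory (haarProbability)
open scoped ENNReal

variable {n : ℕ}

section Charts

variable {φ Z : (Fin n → ℝ) → (Fin n → ℝ)}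
  (hφ : ∀ a i, φ a i = a i * ∏ j ∈ Finset.Iio i, (1 - a j))
  (hZ : ∀ ρ i, Z ρ i = -(2 * π / (n + 1)) * (∑ k : Fin n, ((n : ℝ) - k) * ρ k) + 2 * π * ∑ k ∈ Finset.Iio i, ρ k)

include hφ hZ

/-- **The `SU(N)` spectral coupling layer AS SHIPPED is an exact transport of the product Haar
measure with the booked `coupleJac`.**  Finite link set `ι`, mask `p`; per active link `a` and
frozen links `y`: a staple `S a y` (measurable in `y`), a box flow `χ a y` on `B = (0,1)ⁿ` with
`HasJacobian (Leb|_B) (χ a y) (Jχ a y)` and `χ a y (B) ⊆ B`, the shipped eigenvalue map `f a y`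
(measurable; permutation-equivariant, unimodular, unit product AT INJECTIVE unimodular spectra;
given on `B` by the box flow through the cell charts), the shipped kernel `h a y` following the
recipe at simple spectra, a spectral datum `JD a y` (measurable, symmetric at injective spectra,
booked box-coordinate value on `B`) and the shipped density `j a y ≥ 0` with
`ofReal (j a y W) = JD a y d` at simple spectra; kernel and density JOINTLY MEASURABLE in
`(y, loop)`.  Then the layer `u_a ↦ h a y (u_a S) (u_a S)⁻¹ u_a` (identity on frozen links) has
`HasJacobian (⊗ Haar_{SU(n+1)}) (Theory2.coupleFun p …) (ofReal ∘ Theory2.coupleJac p (j at the loops))`. -/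
theorem hasJacobian_spectralCouplingLayer_sun_shipped {ι : Type*} [Fintype ι]
    (p : ι → Prop) [DecidablePred p]
    (S : {i // p i} → ({i // ¬p i} → Matrix.specialUnitaryGroup (Fin (n + 1)) ℂ) →
      Matrix.specialUnitaryGroup (Fin (n + 1)) ℂ)
    (hS : ∀ a, Measurable (S a))
    (f : {i // p i} → ({i // ¬p i} → Matrix.specialUnitaryGroup (Fin (n + 1)) ℂ) →
      (Fin (n + 1) → ℂ) → (Fin (n + 1) → ℂ))
    (hfm : ∀ a y, Measurable (f a y))
    (hfperm : ∀ a y (σ : Equiv.Perm (Fin (n + 1))) (d : Fin (n + 1) → ℂ), (∀ i, ‖d i‖ = 1) →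
      Function.Injective d → f a y (fun i => d (σ i)) = fun i => f a y d (σ i))
    (χ : {i // p i} → ({i // ¬p i} → Matrix.specialUnitaryGroup (Fin (n + 1)) ℂ) → (Fin n → ℝ) → (Fin n → ℝ))
    (Jχ : {i // p i} → ({i // ¬p i} → Matrix.specialUnitaryGroup (Fin (n + 1)) ℂ) → (Fin n → ℝ) → ℝ≥0∞)
    (hχ : ∀ a y, HasJacobian ((volume : Measure (Fin n → ℝ)).restrict (Set.pi univ fun _ : Fin n => Ioo (0 : ℝ) 1))
      (χ a y) (Jχ a y))
    (hχbox : ∀ a y, ∀ b ∈ Set.pi univ (fun _ : Fin n => Ioo (0 : ℝ) 1),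
      χ a y b ∈ Set.pi univ fun _ : Fin n => Ioo (0 : ℝ) 1)
    (hfG : ∀ a y, ∀ b ∈ Set.pi univ (fun _ : Fin n => Ioo (0 : ℝ) 1),
      f a y (fun i => (Circle.exp ((Fin.snoc (Z (φ b)) (-∑ k, Z (φ b) k) : Fin (n + 1) → ℝ) i) : ℂ)) =
        fun i => (Circle.exp ((Fin.snoc (Z (φ (χ a y b))) (-∑ k, Z (φ (χ a y b)) k) : Fin (n + 1) → ℝ) i) : ℂ))
    (h : {i // p i} → ({i // ¬p i} → Matrix.specialUnitaryGroup (Fin (n + 1)) ℂ) →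
      Matrix.specialUnitaryGroup (Fin (n + 1)) ℂ → Matrix.specialUnitaryGroup (Fin (n + 1)) ℂ)
    (hhm : ∀ a, Measurable fun q : ({i // ¬p i} → Matrix.specialUnitaryGroup (Fin (n + 1)) ℂ) ×
      Matrix.specialUnitaryGroup (Fin (n + 1)) ℂ => h a q.1 q.2)
    (hagree : ∀ a y (Q : Matrix.specialUnitaryGroup (Fin (n + 1)) ℂ) (V : Matrix (Fin (n + 1)) (Fin (n + 1)) ℂ)
      (d : Fin (n + 1) → ℂ), V ∈ Matrix.unitaryGroup (Fin (n + 1)) ℂ → Function.Injective d →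
        (Q : Matrix (Fin (n + 1)) (Fin (n + 1)) ℂ) = V * diagonal d * star V →
        ((h a y Q : Matrix.specialUnitaryGroup (Fin (n + 1)) ℂ) : Matrix (Fin (n + 1)) (Fin (n + 1)) ℂ) =
          V * diagonal (f a y d) * star V)
    (hf1 : ∀ a y (d : Fin (n + 1) → ℂ), (∀ i, ‖d i‖ = 1) → Function.Injective d → ∀ i, ‖f a y d i‖ = 1)
    (hfdet : ∀ a y (d : Fin (n + 1) → ℂ), (∀ i, ‖d i‖ = 1) → Function.Injective d → ∏ i, d i = 1 →
      ∏ i, f a y d i = 1)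
    (JD : {i // p i} → ({i // ¬p i} → Matrix.specialUnitaryGroup (Fin (n + 1)) ℂ) → (Fin (n + 1) → ℂ) → ℝ≥0∞)
    (hJDm : ∀ a y, Measurable (JD a y))
    (hJDperm : ∀ a y (σ : Equiv.Perm (Fin (n + 1))) (d : Fin (n + 1) → ℂ), Function.Injective d →
      JD a y (fun i => d (σ i)) = JD a y d)
    (hJchart : ∀ a y, ∀ b ∈ Set.pi univ (fun _ : Fin n => Ioo (0 : ℝ) 1),
      JD a y (fun i => (Circle.exp ((Fin.snoc (Z (φ b)) (-∑ k, Z (φ b) k) : Fin (n + 1) → ℝ) i) : ℂ)) *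
          ENNReal.ofReal ((∏ i, ∏ k ∈ Finset.univ.erase i,
            ‖(Circle.exp ((Fin.snoc (Z (φ b)) (-∑ k, Z (φ b) k) : Fin (n + 1) → ℝ) i) : ℂ) -
              (Circle.exp ((Fin.snoc (Z (φ b)) (-∑ k, Z (φ b) k) : Fin (n + 1) → ℝ) k) : ℂ)‖) /
                (Fintype.card (Fin (n + 1))).factorial) =
        (ENNReal.ofReal |∏ i : Fin n, ∏ j ∈ Finset.Iio i, (1 - (χ a y b) j)| * Jχ a y b /
            ENNReal.ofReal |∏ i : Fin n, ∏ j ∈ Finset.Iio i, (1 - b j)|) *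
          ENNReal.ofReal ((∏ i, ∏ k ∈ Finset.univ.erase i,
            ‖(Circle.exp ((Fin.snoc (Z (φ (χ a y b))) (-∑ k, Z (φ (χ a y b)) k) : Fin (n + 1) → ℝ) i) : ℂ) -
              (Circle.exp ((Fin.snoc (Z (φ (χ a y b))) (-∑ k, Z (φ (χ a y b)) k) : Fin (n + 1) → ℝ) k) : ℂ)‖) /
                (Fintype.card (Fin (n + 1))).factorial))
    (j : {i // p i} → ({i // ¬p i} → Matrix.specialUnitaryGroup (Fin (n + 1)) ℂ) →
      Matrix.specialUnitaryGroup (Fin (n + 1)) ℂ → ℝ)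
    (hj0 : ∀ a y g, 0 ≤ j a y g)
    (hjm : ∀ a, Measurable fun q : ({i // ¬p i} → Matrix.specialUnitaryGroup (Fin (n + 1)) ℂ) ×
      Matrix.specialUnitaryGroup (Fin (n + 1)) ℂ => j a q.1 q.2)
    (hJspec : ∀ a y (W : Matrix.specialUnitaryGroup (Fin (n + 1)) ℂ) (V : Matrix (Fin (n + 1)) (Fin (n + 1)) ℂ)
      (d : Fin (n + 1) → ℂ), V ∈ Matrix.unitaryGroup (Fin (n + 1)) ℂ → Function.Injective d →
        (W : Matrix (Fin (n + 1)) (Fin (n + 1)) ℂ) = V * diagonal d * star V →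
        ENNReal.ofReal (j a y W) = JD a y d) :
    HasJacobian (Measure.pi fun _ : ι => haarProbability (Matrix.specialUnitaryGroup (Fin (n + 1)) ℂ))
      (Theory2.coupleFun p fun a y u => h a y (u * S a y) * (u * S a y)⁻¹ * u)
      fun U => ENNReal.ofReal (Theory2.coupleJac p (fun a y u => j a y (u * S a y)) U) := by
  haveI : SecondCountableTopology (Matrix (Fin (n + 1)) (Fin (n + 1)) ℂ) :=
    inferInstanceAs (SecondCountableTopology (Fin (n + 1) → Fin (n + 1) → ℂ))
  haveI : SecondCountableTopology (Matrix.specialUnitaryGroup (Fin (n + 1)) ℂ) :=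
    Topology.IsEmbedding.subtypeVal.secondCountableTopology
  -- the loop `u · S(y)` is jointly measurable in (link, frozen links)
  have hloop : ∀ a, Measurable fun q : Matrix.specialUnitaryGroup (Fin (n + 1)) ℂ ×
      ({i // ¬p i} → Matrix.specialUnitaryGroup (Fin (n + 1)) ℂ) => q.1 * S a q.2 := fun a =>
    measurable_fst.mul ((hS a).comp measurable_snd)
  -- slices of the joint measurability
  have hhy : ∀ a y, Measurable (h a y) := fun a y => (hhm a).comp (measurable_const.prodMk measurable_id)
  have hjy : ∀ a y, Measurable fun g => ENNReal.ofReal (j a y g) := fun a y =>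
    ENNReal.measurable_ofReal.comp ((hjm a).comp (measurable_const.prodMk measurable_id))
  obtain ⟨E, -, hE⟩ := exists_angleChart_sun (n := n)
  obtain ⟨P, -, hP⟩ := exists_permDiag_family_sun (n := n)
  refine hasJacobian_kernelCouplingLayer p S h j (fun a => ?_) (fun a => ?_) (fun a y => ?_) hj0
  · exact (((hhm a).comp (measurable_snd.prodMk (hloop a))).mul (hloop a).inv).mul measurable_fst
  · exact (hjm a).comp (measurable_snd.prodMk (hloop a))
  · exact hasJacobian_spectralKernel_sun_shipped hE hP hφ hZ (hfm a y) (hfperm a y) (hχ a y) (hχbox a y) (hfG a y)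
      (hhy a y) (hagree a y) (hf1 a y) (hfdet a y) (hJDm a y) (hJDperm a y) (hJchart a y) (hjy a y) (hJspec a y)

end Charts

end Summit.Ventures.LatticeQCDFlow.Exactness
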